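/-
Copyright (c) 2026. All rights reserved.
Released under Apache 2.0 license as described in the file LICENSE.
Authors: abc-iut cell, prover seat abc-iut-w6-d033 (wave 6, gen 0).
-/
import Literature.AnabelianGeometry.EtaleTheta.KummerKernel
import Literature.AnabelianGeometry.AbsoluteAnabelian.AbsTopIII.KummerFaithful
import Mathlib.CategoryTheory.CofilteredSystem
import Mathlib.Data.Nat.Factorial.Basic
import HarnessLib

/-!
# [AbsTopIII] Definition 1.5: (b) ⟹ (a) — injectivity of the Kummer map forces `⋂_N N·A^H = 0` (finite torsion)

S. Mochizuki, *Topics in Absolute Anabelian Geometry III*, §1, Definition 1.5 (kurims manuscript p. 32, bib key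
`MochizukiAbsTopIII2015`): "… either of the following two equivalent conditions is satisfied: (a) We have
`⋂_{N ≥ 1} N · A(k_H) = {0}` … (b) The associated Kummer map `A(k_H) → H¹(H, Hom(ℚ/ℤ, A(k̄)))` is an injection.
[Indeed, the equivalence (a) ⟺ (b) follows immediately from the long exact sequence …]".

The tree proves (a) ⟹ (b) in abstract form (abc-iut-L2-t3, `EtaleTheta/KummerKernel.lean`:
`kummerMapFixed_injective_of_iInter_pow_eq_bot`, and the exact kernel statement `kummerClass_eq_zero_iff`: the
class of `a ∈ A^H` vanishes iff `a` has a COMPATIBLE system of `H`-invariant roots), and notes that the converse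
"needs finiteness of the torsion to assemble rational roots into a COMPATIBLE system and is not asserted here".
THIS FILE (proof-only: no definitions, no instances) proves that converse under exactly that hypothesis — for a
commutative `G`-group `A` whose `n`-torsion `{z | zⁿ = 1}` is finite for every `n ≥ 1` (true for `A = k̄^×`,
`A(k̄)` of a semi-abelian variety):

* `exists_rootSystem_isInvariant_of_forall_exists_pow` — if `a` has an `H`-invariant `n`-th root for EVERY
  `n ≥ 1`, then `a` has a COMPATIBLE system of `H`-invariant roots (Kőnig's lemma, Mathlib
  `nonempty_sections_of_finite_inverse_system`, applied to the inverse system `k ↦ {b ∈ A^H | b^{k!} = a}` of finite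
  non-empty sets with transition maps `b ↦ b^{k!/k'!}`; the root system is `n ↦ u_{n}^{n!/n}`);
* `kummerClass_eq_zero_of_forall_exists_pow` — hence such an `a` has Kummer class `0`;
* `eq_one_of_forall_exists_pow_of_kummerMapFixed_injective` — **(b) ⟹ (a)**: if the level-`H` Kummer map
  `A^H → H¹(H, Λ(A))` is injective, an element of `A^H` with `n`-th roots in `A^H` for all `n ≥ 1` is trivial;
* `kummerMapFixed_injective_iff_divisibleElementsTrivial` — **(a) ⟺ (b)** in the tree's vocabulary:
  `Function.Injective (kummerMapFixed H) ↔ AbsTopIII.DivisibleElementsTrivial ↥(A^H)` (finite torsion).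

Classical (long exact Kummer sequence / compactness); OUR kernel check; nothing here bears on [IUTchIII] Cor. 3.12
and no side is taken on the disputed corpus. [cite: MochizukiAbsTopIII2015, Def 1.5 p.32]
-/

noncomputable section

namespace Literature.AnabelianGeometry.AbsoluteAnabelian.AbsTopIII

open Literature.AnabelianGeometry.EtaleTheta CategoryTheory Opposite
open scoped Nat

variable {G : Type} [Group G] {A : Type} [CommGroup A] [MulDistribMulAction G A] (H : Subgroup G)

/-- Factorial quotients compose: `(a!/b!)·(b!/c!) = a!/c!` for `c ≤ b ≤ a`. [folklore] -/
private theorem factorial_div_mul_factorial_div {a b c : ℕ} (hab : b ≤ a) (hbc : c ≤ b) :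
    (a ! / b !) * (b ! / c !) = a ! / c ! := by
  rw [Nat.div_mul_div_comm (Nat.factorial_dvd_factorial hab) (Nat.factorial_dvd_factorial hbc),
    mul_comm (b !) (c !), Nat.mul_div_mul_right _ _ (Nat.factorial_pos b)]

/-- `((n·m)!/(n·m))·m = (n·m)!/n`. [folklore] -/
private theorem factorial_mul_div_mul (n m : ℕ) (hn : 0 < n) (hm : 0 < m) :
    ((n * m) ! / (n * m)) * m = (n * m) ! / n := by
  symm
  apply Nat.div_eq_of_eq_mul_left hn
  have hdvd : n * m ∣ (n * m) ! := Nat.dvd_factorial (Nat.mul_pos hn hm) le_rfl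
  calc (n * m) ! = (n * m) ! / (n * m) * (n * m) := (Nat.div_mul_cancel hdvd).symm
    _ = (n * m) ! / (n * m) * m * n := by ring

/-- `((n·m)!/n!)·(n!/n) = (n·m)!/n`. [folklore] -/
private theorem factorial_div_factorial_mul (n m : ℕ) (hn : 0 < n) (hm : 0 < m) :
    ((n * m) ! / n !) * (n ! / n) = (n * m) ! / n := by
  symm
  apply Nat.div_eq_of_eq_mul_left hn
  have h1 : n ! ∣ (n * m) ! := Nat.factorial_dvd_factorial (Nat.le_mul_of_pos_right n hm)
  have h2 : n ∣ n ! := Nat.dvd_factorial hn le_rfl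
  calc (n * m) ! = (n * m) ! / n ! * n ! := (Nat.div_mul_cancel h1).symm
    _ = (n * m) ! / n ! * (n ! / n * n) := by rw [Nat.div_mul_cancel h2]
    _ = (n * m) ! / n ! * (n ! / n) * n := by ring

/-- Powers of `H`-invariant elements are `H`-invariant. [folklore] -/
private theorem pow_mem_invariants {b : A} (hb : b ∈ invariants (A := A) H) (e : ℕ) :
    b ^ e ∈ invariants (A := A) H :=
  (invariants (A := A) H).pow_mem hb e

/-- **Compactness step (Kőnig).** If the `n`-torsion of `A` is finite for every `n ≥ 1` and `a ∈ A` admits, for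
every `n ≥ 1`, SOME `H`-invariant `n`-th root, then `a` admits a COMPATIBLE SYSTEM of `H`-invariant roots
(`RootSystem.IsInvariant`).  Inverse system `k ↦ {b ∈ A^H | b^{k!} = a}` (finite: a translate of the `k!`-torsion;
non-empty by hypothesis; transition `b ↦ b^{k!/k'!}`); a section `u` gives the root system `n ↦ u_n^{n!/n}`.
[cite: MochizukiAbsTopIII2015, Def 1.5 p.32] -/
theorem exists_rootSystem_isInvariant_of_forall_exists_pow
    (hfin : ∀ n : ℕ, 0 < n → {z : A | z ^ n = 1}.Finite) {a : A}
    (h : ∀ n : ℕ, 0 < n → ∃ b ∈ invariants (A := A) H, b ^ n = a) :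
    ∃ x : RootSystem a, x.IsInvariant H := by
  classical
  -- the inverse system of factorial-level invariant roots
  let T : ℕ → Type := fun k => {b : A // b ∈ invariants (A := A) H ∧ b ^ k ! = a}
  have hmap : ∀ {k k' : ℕ}, k' ≤ k → ∀ b : T k,
      b.1 ^ (k ! / k' !) ∈ invariants (A := A) H ∧ (b.1 ^ (k ! / k' !)) ^ k' ! = a := by
    intro k k' hk b
    refine ⟨pow_mem_invariants H b.2.1 _, ?_⟩
    rw [← pow_mul, Nat.div_mul_cancel (Nat.factorial_dvd_factorial hk)]
    exact b.2.2
  -- transition maps `b ↦ b^{k!/k'!}` for `k' ≤ k`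
  let tr : ∀ {k k' : ℕ}, k' ≤ k → T k → T k' := fun {k k'} hk b => ⟨b.1 ^ (k ! / k' !), hmap hk b⟩
  let F : ℕᵒᵖ ⥤ Type :=
    { obj := fun j => T j.unop
      map := fun {j j'} f => TypeCat.ofHom (tr (leOfHom f.unop))
      map_id := fun j => by
        refine ConcreteCategory.hom_ext _ _ fun b => Subtype.ext ?_
        change b.1 ^ (j.unop ! / j.unop !) = b.1
        rw [Nat.div_self (Nat.factorial_pos _), pow_one]
      map_comp := fun {j j' j''} f g => by
        refine ConcreteCategory.hom_ext _ _ fun b => Subtype.ext ?_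
        change b.1 ^ (j.unop ! / j''.unop !) = (b.1 ^ (j.unop ! / j'.unop !)) ^ (j'.unop ! / j''.unop !)
        rw [← pow_mul, factorial_div_mul_factorial_div (leOfHom f.unop) (leOfHom g.unop)] }
  haveI : ∀ j : ℕᵒᵖ, Nonempty (F.obj j) := fun j => by
    obtain ⟨b, hb, hba⟩ := h (j.unop !) (Nat.factorial_pos _)
    exact ⟨⟨b, hb, hba⟩⟩
  haveI : ∀ j : ℕᵒᵖ, Finite (F.obj j) := fun j => by
    obtain ⟨⟨b₀, -, hb₀⟩⟩ := (inferInstance : Nonempty (F.obj j))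
    haveI : Finite {z : A | z ^ (j.unop !) = 1} := (hfin _ (Nat.factorial_pos _)).to_subtype
    refine Finite.of_injective (fun b : T j.unop => (⟨b.1 / b₀, ?_⟩ : {z : A | z ^ (j.unop !) = 1})) ?_
    · change (b.1 / b₀) ^ (j.unop !) = 1
      rw [div_pow, b.2.2, hb₀, div_self']
    · intro b b' hbb'
      have : b.1 / b₀ = b'.1 / b₀ := congrArg Subtype.val hbb'
      exact Subtype.ext (div_left_injective this)
  obtain ⟨u, hu⟩ := nonempty_sections_of_finite_inverse_system F
  -- compatibility of the section along `k' ≤ k`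
  have hcompat : ∀ {k k' : ℕ} (hk : k' ≤ k), (u (op k)).1 ^ (k ! / k' !) = (u (op k')).1 := by
    intro k k' hk
    exact congrArg Subtype.val (hu ((homOfLE hk).op : op k ⟶ op k'))
  refine ⟨⟨fun n => (u (op (n : ℕ))).1 ^ ((n : ℕ) ! / (n : ℕ)), ?_, ?_⟩, ?_⟩
  · -- root_one
    change (u (op 1)).1 ^ (1 ! / 1) = a
    rw [Nat.div_one]
    exact (u (op 1)).2.2
  · -- root_mul_pow
    intro n m
    have hn : 0 < (n : ℕ) := n.pos
    have hm : 0 < (m : ℕ) := m.pos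
    change ((u (op ((n : ℕ) * m))).1 ^ (((n : ℕ) * m) ! / ((n : ℕ) * m))) ^ (m : ℕ) =
      (u (op (n : ℕ))).1 ^ ((n : ℕ) ! / (n : ℕ))
    rw [← hcompat (Nat.le_mul_of_pos_right (n : ℕ) hm), ← pow_mul, ← pow_mul,
      factorial_mul_div_mul _ _ hn hm, factorial_div_factorial_mul _ _ hn hm]
  · -- invariance
    intro n γ
    change (γ : G) • ((u (op (n : ℕ))).1 ^ ((n : ℕ) ! / (n : ℕ))) = (u (op (n : ℕ))).1 ^ ((n : ℕ) ! / (n : ℕ))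
    have hfix : (γ : G) • (u (op (n : ℕ))).1 = (u (op (n : ℕ))).1 := (u (op (n : ℕ))).2.1 γ
    rw [smul_pow', hfix]

variable [RootableBy A ℕ]

/-- **An element of `A^H` with `H`-invariant `n`-th roots for all `n ≥ 1` has Kummer class `0`** (finite torsion):
its class vanishes because it carries a compatible system of `H`-invariant roots (`kummerClass_eq_zero_iff`).
[cite: MochizukiAbsTopIII2015, Def 1.5 p.32] -/
theorem kummerClass_eq_zero_of_forall_exists_pow
    (hfin : ∀ n : ℕ, 0 < n → {z : A | z ^ n = 1}.Finite) (a : invariants (A := A) H)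
    (h : ∀ n : ℕ, 0 < n → ∃ b : invariants (A := A) H, b ^ n = a) :
    kummerClass H a = 0 := by
  rw [kummerClass_eq_zero_iff]
  refine exists_rootSystem_isInvariant_of_forall_exists_pow H hfin fun n hn => ?_
  obtain ⟨b, hb⟩ := h n hn
  exact ⟨b, b.2, by rw [← Subgroup.coe_pow, hb]⟩

/-- **[AbsTopIII] Def 1.5, (b) ⟹ (a)** (finite torsion): if the Kummer map `A^H → H¹(H, Λ(A))` is injective,
then an element of `A^H` admitting `n`-th roots in `A^H` for every `n ≥ 1` is trivial ("`⋂_{N ≥ 1} N·A(k_H) = {0}`").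
[cite: MochizukiAbsTopIII2015, Def 1.5 p.32] -/
theorem eq_one_of_forall_exists_pow_of_kummerMapFixed_injective
    (hfin : ∀ n : ℕ, 0 < n → {z : A | z ^ n = 1}.Finite)
    (hinj : Function.Injective (kummerMapFixed (A := A) H)) (a : invariants (A := A) H)
    (h : ∀ n : ℕ, 0 < n → ∃ b : invariants (A := A) H, b ^ n = a) : a = 1 := by
  have h0 : kummerMapFixed (A := A) H (Additive.ofMul a) = kummerMapFixed (A := A) H (Additive.ofMul 1) := by
    rw [kummerMapFixed_apply, kummerMapFixed_apply, kummerClass_eq_zero_of_forall_exists_pow H hfin a h]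
    exact (kummerClass_one H).symm
  exact Additive.ofMul.injective (hinj h0)

/-- **[AbsTopIII] Def 1.5, (a) ⟺ (b)** in the tree's vocabulary (finite torsion): the level-`H` Kummer map
`A^H → H¹(H, Λ(A))` is injective iff `A^H` has no non-trivial infinitely divisible element
(`AbsTopIII.DivisibleElementsTrivial ↥(A^H)` = "`⋂_{N ≥ 1} N·A(k_H) = {0}`").  (⇐) is abc-iut-L2-t3's
`kummerMapFixed_injective_of_iInter_pow_eq_bot`; (⇒) is the compactness argument above.
[cite: MochizukiAbsTopIII2015, Def 1.5 p.32] -/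
theorem kummerMapFixed_injective_iff_divisibleElementsTrivial
    (hfin : ∀ n : ℕ, 0 < n → {z : A | z ^ n = 1}.Finite) :
    Function.Injective (kummerMapFixed (A := A) H) ↔ DivisibleElementsTrivial ↥(invariants (A := A) H) := by
  constructor
  · intro hinj
    exact ⟨fun a ha => eq_one_of_forall_exists_pow_of_kummerMapFixed_injective H hfin hinj a ha⟩
  · intro hA
    refine kummerMapFixed_injective_of_iInter_pow_eq_bot H fun a ha => hA.eq_one_of_forall_exists_pow a ?_
    intro n hn
    obtain ⟨b, hb⟩ := ha ⟨n, hn⟩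
    exact ⟨b, hb⟩

end Literature.AnabelianGeometry.AbsoluteAnabelian.AbsTopIII

end
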